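import Literature.NumberTheory.Transcendental.KaehlerHodgeEllipticReductionProofs
import Literature.NumberTheory.Transcendental.KaehlerHodgeComplexAtlasFact
import Literature.Geometry.Kaehler.TorusDolbeaultCompactAll
import HarnessLib

/-!
# `ℋ^{p,q}` is finite-dimensional on a compact Hermitian manifold (discharge of `finite_dolbeaultHarmonicForms_of_isManifold`)

Trunk **T-KAEHLER** (`NumberTheory/Transcendental`). Theorems-only leaf companion of
`KaehlerHodgeComplexAtlasFact.lean` (the corrected named fact
`Literature.NumberTheory.Transcendental.finite_dolbeaultHarmonicForms_of_isManifold g o`: on a compact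
Hausdorff COMPLEX manifold `M` (holomorphic atlas `[IsManifold 𝓘(ℂ, E) ω M]`, a binder of the `def`)
with a smooth metric `g` on the real tangent bundle which is Hermitian, and an orientation family `o`
with smooth volume form, the space `ℋ^{p,q} = dolbeaultHarmonicForms o p q h` of `∂̄`-harmonic
`(p,q)`-forms is finite-dimensional; C. Voisin, *Hodge Theory and Complex Algebraic Geometry I*
(2002), §5.3.1 Thm. 5.22 (compactness of the resolvent of an elliptic operator) ⇒ Thm. 5.24 (ii);
F. W. Warner, GTM 94 (1983), Thm. 6.6) and of the reduction
`finite_dolbeaultHarmonicForms_of_compactness` (`KaehlerHodgeEllipticReductionProofs.lean`): the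
kernel of `Δ_∂̄` on `A^{p,q}(M)` is finite-dimensional as soon as Warner's Theorem 6.6 holds for
`Δ_∂̄` on `A^{p,q}(M)` (`AbstractHodge.finiteDimensional_ker`: a normed space in which bounded
sequences have Cauchy subsequences is finite-dimensional), bidegrees `p + q ≠ k` being trivial.

That compactness input is a THEOREM of the tree's periodic-elliptic programme for every smooth
Hermitian metric: `CL2SmoothForms.pq_compact` (`Literature/Geometry/Kaehler/TorusDolbeaultCompactAll.lean`),
in exactly the binder shape the reduction asks for.

* **`finite_dolbeaultHarmonicForms_of_isManifold_holds`** — discharge of the corrected named fact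
  (via `finite_dolbeaultHarmonicForms_of_isManifold_iff`, same body as the old `Prop`).
* `finite_dolbeaultHarmonicForms_of_isManifold_complex` — the old C12 name
  `finite_dolbeaultHarmonicForms g o` at a COMPLEX manifold (its closed reading without the
  holomorphic atlas is refuted in `KaehlerHodgeFiniteCounterexample.lean` /
  `KaehlerHodgeTwistedTorusCounterexample.lean`, so this is the strongest true form).
* `module_finite_dolbeaultHarmonicForms_of_isHermitian` — binder form: the instance
  `Module.Finite ℂ ℋ^{p,q}_g` for a compact Hausdorff complex manifold with a smooth Hermitian `g`.

No definition and no named fact is introduced (D-0026).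

## References

* C. Voisin, *Hodge Theory and Complex Algebraic Geometry I* (2002), §5.3.1 Thm. 5.22, Thm. 5.24.
  [VoisinHodgeI2002] [Voisin2002]
* F. W. Warner, *Foundations of Differentiable Manifolds and Lie Groups*, GTM 94 (1983), Thm. 6.6.
  [WarnerGTM94]
-/

noncomputable section

open scoped Manifold ContDiff Topology
open Bundle Module Literature.Geometry.Kaehler

namespace Literature.NumberTheory.Transcendental

-- The identification `TangentSpace I x = E` is an abuse of definitional equality (see
-- `NormedSpace.fromTangentSpace`); as in Mathlib's tangent-bundle files we let `isDefEq` unfold it.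
set_option backward.isDefEq.respectTransparency false

variable {E : Type*} [NormedAddCommGroup E] [NormedSpace ℂ E] [FiniteDimensional ℂ E]
  {n : ℕ} [Fact (finrank ℝ E = n)]
  {M : Type*} [TopologicalSpace M] [ChartedSpace E M]
  [IsManifold 𝓘(ℂ, E) ω M] [IsManifold 𝓘(ℝ, E) ∞ M] {k m : ℕ}
  (g : ContMDiffRiemannianMetric 𝓘(ℝ, E) ∞ E (fun x : M ↦ TangentSpace 𝓘(ℝ, E) x))
  (o : (x : M) → Orientation ℝ (TangentSpace 𝓘(ℝ, E) x) (Fin n))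

/-- The old C12 name **`finite_dolbeaultHarmonicForms g o` holds at every complex manifold**: for a
smooth metric `g` and orientation family `o` on a compact Hausdorff complex manifold — if `g` is
Hermitian and the volume form of `o` is smooth, `ℋ^{p,q}` is finite-dimensional (all bidegrees
`p, q` and degree witnesses `h : k + m = n`). `finite_dolbeaultHarmonicForms_of_compactness` fed
Warner's Theorem 6.6 for `Δ_∂̄` on `A^{p,q}(M)` (`CL2SmoothForms.pq_compact`).
[cite: VoisinHodgeI2002, §5.3.1 Thm. 5.24 (ii)] -/
theorem finite_dolbeaultHarmonicForms_of_isManifold_complex :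
    finite_dolbeaultHarmonicForms (k := k) (m := m) g o := by
  refine finite_dolbeaultHarmonicForms_of_compactness (k := k) (m := m) o g ?_
  intro _ _ _ _ hJ p q h ho
  letI : RiemannianBundle (fun x : M ↦ TangentSpace 𝓘(ℝ, E) x) := ⟨g.toRiemannianMetric⟩
  haveI : IsContMDiffRiemannianBundle 𝓘(ℝ, E) ∞ E (fun x : M ↦ TangentSpace 𝓘(ℝ, E) x) :=
    ⟨g.inner, g.contMDiff, fun _ _ _ ↦ rfl⟩
  haveI : Fact (IsSmoothForm (riemannianVolumeForm o)) := ⟨ho⟩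
  exact fun u c hb hΔ ↦ CL2SmoothForms.pq_compact o hJ p q h u c hb hΔ

/-- **`ℋ^{p,q}` is finite-dimensional on a compact Hermitian manifold** (discharge of the corrected
named fact `finite_dolbeaultHarmonicForms_of_isManifold g o`; Voisin (2002), Thm. 5.24 (ii) from
Thm. 5.22): same body as the old `Prop` (`finite_dolbeaultHarmonicForms_of_isManifold_iff`).
[cite: VoisinHodgeI2002, §5.3.1 Thm. 5.24 (ii)] -/
theorem finite_dolbeaultHarmonicForms_of_isManifold_holds :
    finite_dolbeaultHarmonicForms_of_isManifold (k := k) (m := m) g o :=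
  (finite_dolbeaultHarmonicForms_of_isManifold_iff g o).2
    (finite_dolbeaultHarmonicForms_of_isManifold_complex g o)

/-- **Binder form**: on a compact Hausdorff complex manifold with a smooth Hermitian metric `g`
(installed as the Riemannian bundle structure) and an orientation family with smooth volume form,
`Module.Finite ℂ ℋ^{p,q}`. [cite: VoisinHodgeI2002, §5.3.1 Thm. 5.24 (ii)] -/
theorem module_finite_dolbeaultHarmonicForms_of_isHermitian [CompactSpace M] [T2Space M]
    (hg : g.toRiemannianMetric.IsHermitian) {p q : ℕ} (h : k + m = n)
    (ho : letI : RiemannianBundle (fun x : M ↦ TangentSpace 𝓘(ℝ, E) x) := ⟨g.toRiemannianMetric⟩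
      IsSmoothForm (riemannianVolumeForm o)) :
    letI : RiemannianBundle (fun x : M ↦ TangentSpace 𝓘(ℝ, E) x) := ⟨g.toRiemannianMetric⟩
    Module.Finite ℂ ↥(dolbeaultHarmonicForms o p q h) :=
  finite_dolbeaultHarmonicForms_of_isManifold_complex g o hg h ho

end Literature.NumberTheory.Transcendental

end
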